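import Literature.Analysis.FunctionSpaces.PolchinskiCb2Calculus
import Literature.Analysis.FunctionSpaces.PolchinskiBochnerAlgebra
import HarnessLib

/-!
# The spatial jets of `P_{0,t}F = W/Z`, `∇P_{0,t}F`, `(∇√P_{0,t}F)²_{Ċ_t}` and the pointwise exchange
# inequality `(L_t − ∂_t)(∇√P_{0,t}F)²_{Ċ_t} ≥ 2λ̇_t (∇√P_{0,t}F)²_{Ċ_t}` (Bauerschmidt–Bodineau–Dagallier, Lemma 1)

Topic `Literature/Analysis/FunctionSpaces`; "proof architecture" file behind the named fact
`Polchinski.BauerschmidtBodineau_multiscaleBakryEmery` ([BBD] Theorem 3, `MultiscaleBakryEmery.lean`).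

[BBD] prove Theorem 3 (p0016) from Lemma 1 (p0016 L115–p0017), the Bochner-type formula
`(L_t − ∂_t)(∇√P_{0,t}F)²_{Ċ_t} = 2(∇√·)Ċ_t Hess V_t Ċ_t(∇√·) − (∇√·)C̈_t(∇√·) + (nonnegative)`, whose
right-hand side is `≥ 2λ̇_t (∇√P_{0,t}F)²_{Ċ_t}` under the multiscale condition (e:assCt-mon).  The algebra
of that formula is `bochner_sqrt_ineq` (`PolchinskiBochnerAlgebra.lean`), stated for the JETS of
`u = W/Z` (`W = E_{C_t}[e^{−V₀}F(·+ζ)]`, `Z = E_{C_t}[e^{−V₀}(·+ζ)]`, [BBD] proof of Prop 8 p0015 L9–12).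
This file performs the differential calculus that feeds it, ABSTRACTLY in the four "atoms" `Z`, `W`,
`Z₁ₖ = ∂_kZ`, `W₁ₖ = ∂_kW` given with `C_b²` data (`PolchinskiCb2Calculus.lean`; the concrete Gaussian
averages are supplied by `PolchinskiSemigroupJets.lean`):

* `quotient_jets` — `C_b²` data of `u = W/Z` with the explicit first and second derivatives;
* `gradQuotient_jets` — `C_b²` data of `g_k = ∂_k u = W₁ₖ/Z − W Z₁ₖ/Z²` with explicit derivatives
  (third-order jets);
* `quadForm_jets` — `C_b²` data of `A = Σ Ċ^{kl} g_k g_l = (∇u)²_{Ċ}`;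
* `sqrtEnergy_jets` — `C_b²` data of `H = A/(4u) = (∇√u)²_{Ċ}`;
* **`sqrtGradient_exchange`** — for `H` as above: the `C_b²` data AND, at every point, the inequality
  `2λ H ≤ (½Σ Ċ^{ij}∂_i∂_jH − Σ Ċ^{ij}∂_iV_t ∂_jH) − Ḣ`, where `Ḣ` is the time slope of `H` expressed through
  the slopes `Ż, Ẇ, Ż₁, Ẇ₁` of the atoms (heat equations, [BBD] Prop 5) and the hypothesis is the multiscale
  condition at the point in jet form (`Hess V_t = −∂²Z/Z + ∂Z⊗∂Z/Z²`).

All statements are pure finite-dimensional calculus; no measure theory.  Nothing here concerns Yang–Mills.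

## References

* [BauerschmidtBodineauDagallier2023] R. Bauerschmidt, T. Bodineau, B. Dagallier, Probab. Surveys 21
  (2024) 200–290, arXiv:2307.07619 — Prop 8 proof p0015, Theorem 3 proof p0016, Lemma 1 p0016–p0017. READ.
* [Rudin1976] W. Rudin, Principles of Mathematical Analysis — Thm 5.3 (product/quotient rules), 9.19.
-/

noncomputable section

-- nested operator-norm instances `E →L[ℝ] E →L[ℝ] ℝ`
set_option maxSynthPendingDepth 3

open Filter Topology Set
open scoped Matrix

namespace Literature.Analysis.FunctionSpaces

namespace Polchinski

variable {N : ℕ}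

section Helpers

/-- Weakening the constants of `C_b²` data. [folklore] -/
private theorem pack_mono {f : EuclideanSpace ℝ (Fin N) → ℝ}
    {f1 : EuclideanSpace ℝ (Fin N) → EuclideanSpace ℝ (Fin N) →L[ℝ] ℝ}
    {f2 : EuclideanSpace ℝ (Fin N) → EuclideanSpace ℝ (Fin N) →L[ℝ] EuclideanSpace ℝ (Fin N) →L[ℝ] ℝ}
    {K0 K1 K2 K0' K1' K2' : ℝ}
    (h : (∀ x, HasFDerivAt f (f1 x) x) ∧ (∀ x, HasFDerivAt f1 (f2 x) x) ∧ (∀ x, |f x| ≤ K0) ∧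
      (∀ x, ‖f1 x‖ ≤ K1) ∧ (∀ x, ‖f2 x‖ ≤ K2) ∧ UniformContinuous f2)
    (h0 : K0 ≤ K0') (h1 : K1 ≤ K1') (h2 : K2 ≤ K2') :
    (∀ x, HasFDerivAt f (f1 x) x) ∧ (∀ x, HasFDerivAt f1 (f2 x) x) ∧ (∀ x, |f x| ≤ K0') ∧
      (∀ x, ‖f1 x‖ ≤ K1') ∧ (∀ x, ‖f2 x‖ ≤ K2') ∧ UniformContinuous f2 :=
  ⟨h.1, h.2.1, fun x => (h.2.2.1 x).trans h0, fun x => (h.2.2.2.1 x).trans h1,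
    fun x => (h.2.2.2.2.1 x).trans h2, h.2.2.2.2.2⟩

/-- `K k ≤ Σ_j |K j|`. [folklore] -/
private theorem le_sum_abs (K : Fin N → ℝ) (k : Fin N) : K k ≤ ∑ j, |K j| :=
  (le_abs_self _).trans
    (Finset.single_le_sum (f := fun j => |K j|) (fun _ _ => abs_nonneg _) (Finset.mem_univ k))

end Helpers

/-! ### Jets of `u = W/Z`, `g_k = ∂_k u`, `A = (∇u)²_{Ċ}`, `H = A/(4u)` -/

section Jets

variable {Z W : EuclideanSpace ℝ (Fin N) → ℝ}
  {DZ DW : EuclideanSpace ℝ (Fin N) → EuclideanSpace ℝ (Fin N) →L[ℝ] ℝ}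
  {D2Z D2W : EuclideanSpace ℝ (Fin N) → EuclideanSpace ℝ (Fin N) →L[ℝ] EuclideanSpace ℝ (Fin N) →L[ℝ] ℝ}
  {KZ0 KZ1 KZ2 KW0 KW1 KW2 m : ℝ}

/-- **Jets of the quotient `u = W/Z`** ([BBD] `P_{0,t}F = E_{C_t}[e^{−V₀}F(·+ζ)]/E_{C_t}[e^{−V₀}(·+ζ)]`, proof of
Prop 8): `C_b²` data with `∂_v u = ∂_vW/Z − W∂_vZ/Z²` and the explicit second derivative.
[cite: BauerschmidtBodineauDagallier2023, Proposition 8 (proof)] -/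
theorem quotient_jets
    (pZ : (∀ x, HasFDerivAt Z (DZ x) x) ∧ (∀ x, HasFDerivAt DZ (D2Z x) x) ∧ (∀ x, |Z x| ≤ KZ0) ∧
      (∀ x, ‖DZ x‖ ≤ KZ1) ∧ (∀ x, ‖D2Z x‖ ≤ KZ2) ∧ UniformContinuous D2Z)
    (pW : (∀ x, HasFDerivAt W (DW x) x) ∧ (∀ x, HasFDerivAt DW (D2W x) x) ∧ (∀ x, |W x| ≤ KW0) ∧
      (∀ x, ‖DW x‖ ≤ KW1) ∧ (∀ x, ‖D2W x‖ ≤ KW2) ∧ UniformContinuous D2W)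
    (hm : 0 < m) (hmZ : ∀ x, m ≤ Z x)
    (u : EuclideanSpace ℝ (Fin N) → ℝ) (hu : ∀ x, u x = W x * (Z x)⁻¹) :
    ∃ (Du : EuclideanSpace ℝ (Fin N) → EuclideanSpace ℝ (Fin N) →L[ℝ] ℝ)
      (D2u : EuclideanSpace ℝ (Fin N) → EuclideanSpace ℝ (Fin N) →L[ℝ] EuclideanSpace ℝ (Fin N) →L[ℝ] ℝ)
      (K1 K2 : ℝ),
      ((∀ x, HasFDerivAt u (Du x) x) ∧ (∀ x, HasFDerivAt Du (D2u x) x) ∧ (∀ x, |u x| ≤ KW0 * m⁻¹) ∧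
        (∀ x, ‖Du x‖ ≤ K1) ∧ (∀ x, ‖D2u x‖ ≤ K2) ∧ UniformContinuous D2u) ∧
      (∀ x v, Du x v = DW x v / Z x - W x * DZ x v / Z x ^ 2) ∧
      (∀ x v w, D2u x v w = D2W x v w / Z x - DW x v * DZ x w / Z x ^ 2 - DW x w * DZ x v / Z x ^ 2
        - W x * D2Z x v w / Z x ^ 2 + 2 * W x * DZ x w * DZ x v / Z x ^ 3) := by
  have hu' : u = fun x => W x * (Z x)⁻¹ := funext hu
  subst hu'
  have pu := cb2_mul pW (cb2_inv pZ hm hmZ)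
  refine ⟨_, _, _, _, pu, fun x v => ?_, fun x v w => ?_⟩
  · have hZ : Z x ≠ 0 := (hm.trans_le (hmZ x)).ne'
    simp only [_root_.add_apply, _root_.smul_apply, smul_eq_mul]
    field_simp
    ring
  · have hZ : Z x ≠ 0 := (hm.trans_le (hmZ x)).ne'
    simp only [_root_.add_apply, _root_.smul_apply,
      ContinuousLinearMap.smulRight_apply, smul_eq_mul]
    field_simp
    ring

/-- **Jets of the gradient `g_k = ∂_k(W/Z) = W₁ₖ/Z − W Z₁ₖ/Z²`** in terms of the atoms `Z, W, Z₁ₖ = ∂_kZ,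
W₁ₖ = ∂_kW`: `C_b²` data with the explicit first and second derivatives (the third-order jets entering
Lemma 1 of [BBD]). [cite: BauerschmidtBodineauDagallier2023, Lemma 1 (proof)] -/
theorem gradQuotient_jets
    (pZ : (∀ x, HasFDerivAt Z (DZ x) x) ∧ (∀ x, HasFDerivAt DZ (D2Z x) x) ∧ (∀ x, |Z x| ≤ KZ0) ∧
      (∀ x, ‖DZ x‖ ≤ KZ1) ∧ (∀ x, ‖D2Z x‖ ≤ KZ2) ∧ UniformContinuous D2Z)
    (pW : (∀ x, HasFDerivAt W (DW x) x) ∧ (∀ x, HasFDerivAt DW (D2W x) x) ∧ (∀ x, |W x| ≤ KW0) ∧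
      (∀ x, ‖DW x‖ ≤ KW1) ∧ (∀ x, ‖D2W x‖ ≤ KW2) ∧ UniformContinuous D2W)
    {Z1k W1k : EuclideanSpace ℝ (Fin N) → ℝ}
    {DZ1k DW1k : EuclideanSpace ℝ (Fin N) → EuclideanSpace ℝ (Fin N) →L[ℝ] ℝ}
    {D2Z1k D2W1k : EuclideanSpace ℝ (Fin N) →
      EuclideanSpace ℝ (Fin N) →L[ℝ] EuclideanSpace ℝ (Fin N) →L[ℝ] ℝ}
    {LZ0 LZ1 LZ2 LW0 LW1 LW2 : ℝ}
    (pZ1 : (∀ x, HasFDerivAt Z1k (DZ1k x) x) ∧ (∀ x, HasFDerivAt DZ1k (D2Z1k x) x) ∧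
      (∀ x, |Z1k x| ≤ LZ0) ∧ (∀ x, ‖DZ1k x‖ ≤ LZ1) ∧ (∀ x, ‖D2Z1k x‖ ≤ LZ2) ∧ UniformContinuous D2Z1k)
    (pW1 : (∀ x, HasFDerivAt W1k (DW1k x) x) ∧ (∀ x, HasFDerivAt DW1k (D2W1k x) x) ∧
      (∀ x, |W1k x| ≤ LW0) ∧ (∀ x, ‖DW1k x‖ ≤ LW1) ∧ (∀ x, ‖D2W1k x‖ ≤ LW2) ∧ UniformContinuous D2W1k)
    (hm : 0 < m) (hmZ : ∀ x, m ≤ Z x)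
    (gk : EuclideanSpace ℝ (Fin N) → ℝ)
    (hg : ∀ x, gk x = W1k x * (Z x)⁻¹ - W x * (Z1k x * ((Z x)⁻¹ * (Z x)⁻¹))) :
    ∃ (Dg : EuclideanSpace ℝ (Fin N) → EuclideanSpace ℝ (Fin N) →L[ℝ] ℝ)
      (D2g : EuclideanSpace ℝ (Fin N) → EuclideanSpace ℝ (Fin N) →L[ℝ] EuclideanSpace ℝ (Fin N) →L[ℝ] ℝ)
      (K0 K1 K2 : ℝ),
      ((∀ x, HasFDerivAt gk (Dg x) x) ∧ (∀ x, HasFDerivAt Dg (D2g x) x) ∧ (∀ x, |gk x| ≤ K0) ∧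
        (∀ x, ‖Dg x‖ ≤ K1) ∧ (∀ x, ‖D2g x‖ ≤ K2) ∧ UniformContinuous D2g) ∧
      (∀ x v, Dg x v = DW1k x v / Z x - W1k x * DZ x v / Z x ^ 2 - DW x v * Z1k x / Z x ^ 2
        - W x * DZ1k x v / Z x ^ 2 + 2 * W x * Z1k x * DZ x v / Z x ^ 3) ∧
      (∀ x v w, D2g x v w =
        D2W1k x v w / Z x - DW1k x v * DZ x w / Z x ^ 2 - DW1k x w * DZ x v / Z x ^ 2
        - W1k x * D2Z x v w / Z x ^ 2 + 2 * W1k x * DZ x v * DZ x w / Z x ^ 3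
        - D2W x v w * Z1k x / Z x ^ 2 - DW x v * DZ1k x w / Z x ^ 2 + 2 * DW x v * Z1k x * DZ x w / Z x ^ 3
        - DW x w * DZ1k x v / Z x ^ 2 - W x * D2Z1k x v w / Z x ^ 2 + 2 * W x * DZ1k x v * DZ x w / Z x ^ 3
        + 2 * DW x w * Z1k x * DZ x v / Z x ^ 3 + 2 * W x * DZ1k x w * DZ x v / Z x ^ 3
        + 2 * W x * Z1k x * D2Z x v w / Z x ^ 3 - 6 * W x * Z1k x * DZ x v * DZ x w / Z x ^ 4) := by
  have hg' : gk = fun x => W1k x * (Z x)⁻¹ - W x * (Z1k x * ((Z x)⁻¹ * (Z x)⁻¹)) := funext hg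
  subst hg'
  have pI := cb2_inv pZ hm hmZ
  have pg := cb2_sub (cb2_mul pW1 pI) (cb2_mul pW (cb2_mul pZ1 (cb2_mul pI pI)))
  refine ⟨_, _, _, _, _, pg, fun x v => ?_, fun x v w => ?_⟩
  · have hZ : Z x ≠ 0 := (hm.trans_le (hmZ x)).ne'
    simp only [_root_.add_apply, _root_.sub_apply,
      _root_.smul_apply, smul_eq_mul]
    field_simp
    ring
  · have hZ : Z x ≠ 0 := (hm.trans_le (hmZ x)).ne'
    simp only [_root_.add_apply, _root_.sub_apply,
      _root_.smul_apply, ContinuousLinearMap.smulRight_apply, smul_eq_mul]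
    field_simp
    ring

/-- **Jets of the quadratic form `A = Σ_{kl} Ċ^{kl} g_k g_l = (∇u)²_{Ċ}`** from `C_b²` data of the `g_k`.
[cite: BauerschmidtBodineauDagallier2023, Lemma 1 (proof)] -/
theorem quadForm_jets {g : Fin N → EuclideanSpace ℝ (Fin N) → ℝ}
    {Dg : Fin N → EuclideanSpace ℝ (Fin N) → EuclideanSpace ℝ (Fin N) →L[ℝ] ℝ}
    {D2g : Fin N → EuclideanSpace ℝ (Fin N) →
      EuclideanSpace ℝ (Fin N) →L[ℝ] EuclideanSpace ℝ (Fin N) →L[ℝ] ℝ} {G0 G1 G2 : ℝ}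
    (pg : ∀ k, (∀ x, HasFDerivAt (g k) (Dg k x) x) ∧ (∀ x, HasFDerivAt (Dg k) (D2g k x) x) ∧
      (∀ x, |g k x| ≤ G0) ∧ (∀ x, ‖Dg k x‖ ≤ G1) ∧ (∀ x, ‖D2g k x‖ ≤ G2) ∧ UniformContinuous (D2g k))
    (C : Matrix (Fin N) (Fin N) ℝ)
    (A : EuclideanSpace ℝ (Fin N) → ℝ) (hA : ∀ x, A x = ∑ k, ∑ l, C k l * (g k x * g l x)) :
    ∃ (DA : EuclideanSpace ℝ (Fin N) → EuclideanSpace ℝ (Fin N) →L[ℝ] ℝ)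
      (D2A : EuclideanSpace ℝ (Fin N) → EuclideanSpace ℝ (Fin N) →L[ℝ] EuclideanSpace ℝ (Fin N) →L[ℝ] ℝ)
      (K0 K1 K2 : ℝ),
      ((∀ x, HasFDerivAt A (DA x) x) ∧ (∀ x, HasFDerivAt DA (D2A x) x) ∧ (∀ x, |A x| ≤ K0) ∧
        (∀ x, ‖DA x‖ ≤ K1) ∧ (∀ x, ‖D2A x‖ ≤ K2) ∧ UniformContinuous D2A) ∧
      (∀ x v, DA x v = ∑ k, ∑ l, C k l * (g k x * Dg l x v + g l x * Dg k x v)) ∧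
      (∀ x v w, D2A x v w = ∑ k, ∑ l, C k l *
        (g k x * D2g l x v w + Dg k x v * Dg l x w + (g l x * D2g k x v w + Dg l x v * Dg k x w))) := by
  have hA' : A = fun x => ∑ k, ∑ l, C k l * (g k x * g l x) := funext hA
  subst hA'
  set KC : ℝ := ∑ k, ∑ l, |C k l| with hKC
  have hCle : ∀ k l, |C k l| ≤ KC := fun k l => by
    rw [hKC]
    calc |C k l| ≤ ∑ l', |C k l'| :=
          Finset.single_le_sum (f := fun l' => |C k l'|) (fun _ _ => abs_nonneg _) (Finset.mem_univ l)
      _ ≤ ∑ k', ∑ l', |C k' l'| :=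
          Finset.single_le_sum (f := fun k' => ∑ l', |C k' l'|)
            (fun _ _ => Finset.sum_nonneg fun _ _ => abs_nonneg _) (Finset.mem_univ k)
  have hkl : ∀ k l,
      (∀ x, HasFDerivAt (fun x => C k l * (g k x * g l x)) (C k l • (g k x • Dg l x + g l x • Dg k x)) x) ∧
      (∀ x, HasFDerivAt (fun x => C k l • (g k x • Dg l x + g l x • Dg k x))
        (C k l • (g k x • D2g l x + (Dg k x).smulRight (Dg l x) +
          (g l x • D2g k x + (Dg l x).smulRight (Dg k x)))) x) ∧
      (∀ x, |C k l * (g k x * g l x)| ≤ KC * (G0 * G0)) ∧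
      (∀ x, ‖C k l • (g k x • Dg l x + g l x • Dg k x)‖ ≤ KC * (G0 * G1 + G0 * G1)) ∧
      (∀ x, ‖C k l • (g k x • D2g l x + (Dg k x).smulRight (Dg l x) +
          (g l x • D2g k x + (Dg l x).smulRight (Dg k x)))‖ ≤
            KC * (G0 * G2 + G1 * G1 + (G0 * G2 + G1 * G1))) ∧
      UniformContinuous (fun x => C k l • (g k x • D2g l x + (Dg k x).smulRight (Dg l x) +
          (g l x • D2g k x + (Dg l x).smulRight (Dg k x)))) := by
    intro k l
    have hG0 : 0 ≤ G0 := le_trans (abs_nonneg _) ((pg k).2.2.1 0)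
    have hG1 : 0 ≤ G1 := le_trans (norm_nonneg _) ((pg k).2.2.2.1 0)
    have hG2 : 0 ≤ G2 := le_trans (norm_nonneg _) ((pg k).2.2.2.2.1 0)
    refine pack_mono (cb2_const_mul (C k l) (cb2_mul (pg k) (pg l))) ?_ ?_ ?_
    · exact mul_le_mul_of_nonneg_right (hCle k l) (by positivity)
    · exact mul_le_mul_of_nonneg_right (hCle k l) (by positivity)
    · exact mul_le_mul_of_nonneg_right (hCle k l) (by positivity)
  have inner := fun k => cb2_sum Finset.univ (fun l _ => hkl k l)
  have outer := cb2_sum Finset.univ (fun k _ => inner k)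
  refine ⟨_, _, _, _, _, outer, fun x v => ?_, fun x v w => ?_⟩
  · simp only [_root_.sum_apply, _root_.add_apply,
      _root_.smul_apply, smul_eq_mul]
  · simp only [_root_.sum_apply, _root_.add_apply,
      _root_.smul_apply, ContinuousLinearMap.smulRight_apply, smul_eq_mul]

/-- **Jets of `H = A/(4u) = (∇√u)²_{Ċ}`** from `C_b²` data of `A = (∇u)²_{Ċ}` and of `u ≥ a > 0`
(`(∇√F)² = (∇F)²/(4F)`). [cite: BauerschmidtBodineauDagallier2023, Lemma 1 (proof)] -/
theorem sqrtEnergy_jets {u A : EuclideanSpace ℝ (Fin N) → ℝ}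
    {Du DA : EuclideanSpace ℝ (Fin N) → EuclideanSpace ℝ (Fin N) →L[ℝ] ℝ}
    {D2u D2A : EuclideanSpace ℝ (Fin N) → EuclideanSpace ℝ (Fin N) →L[ℝ] EuclideanSpace ℝ (Fin N) →L[ℝ] ℝ}
    {U0 U1 U2 A0 A1 A2 : ℝ}
    (pu : (∀ x, HasFDerivAt u (Du x) x) ∧ (∀ x, HasFDerivAt Du (D2u x) x) ∧ (∀ x, |u x| ≤ U0) ∧
      (∀ x, ‖Du x‖ ≤ U1) ∧ (∀ x, ‖D2u x‖ ≤ U2) ∧ UniformContinuous D2u)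
    (pA : (∀ x, HasFDerivAt A (DA x) x) ∧ (∀ x, HasFDerivAt DA (D2A x) x) ∧ (∀ x, |A x| ≤ A0) ∧
      (∀ x, ‖DA x‖ ≤ A1) ∧ (∀ x, ‖D2A x‖ ≤ A2) ∧ UniformContinuous D2A)
    {a : ℝ} (ha : 0 < a) (hau : ∀ x, a ≤ u x)
    (H : EuclideanSpace ℝ (Fin N) → ℝ) (hH : ∀ x, H x = (1 / 4) * (A x * (u x)⁻¹)) :
    ∃ (DH : EuclideanSpace ℝ (Fin N) → EuclideanSpace ℝ (Fin N) →L[ℝ] ℝ)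
      (D2H : EuclideanSpace ℝ (Fin N) → EuclideanSpace ℝ (Fin N) →L[ℝ] EuclideanSpace ℝ (Fin N) →L[ℝ] ℝ)
      (K0 K1 K2 : ℝ),
      ((∀ x, HasFDerivAt H (DH x) x) ∧ (∀ x, HasFDerivAt DH (D2H x) x) ∧ (∀ x, |H x| ≤ K0) ∧
        (∀ x, ‖DH x‖ ≤ K1) ∧ (∀ x, ‖D2H x‖ ≤ K2) ∧ UniformContinuous D2H) ∧
      (∀ x v, DH x v = DA x v / (4 * u x) - A x * Du x v / (4 * u x ^ 2)) ∧
      (∀ x v w, D2H x v w = D2A x v w / (4 * u x) - (DA x w * Du x v + DA x v * Du x w) / (4 * u x ^ 2)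
        - A x * D2u x v w / (4 * u x ^ 2) + 2 * A x * (Du x v * Du x w) / (4 * u x ^ 3)) := by
  have hH' : H = fun x => (1 / 4) * (A x * (u x)⁻¹) := funext hH
  subst hH'
  have pH := cb2_const_mul (1 / 4 : ℝ) (cb2_mul pA (cb2_inv pu ha hau))
  refine ⟨_, _, _, _, _, pH, fun x v => ?_, fun x v w => ?_⟩
  · have hux : u x ≠ 0 := (ha.trans_le (hau x)).ne'
    simp only [_root_.add_apply, _root_.smul_apply, smul_eq_mul]
    field_simp
    ring
  · have hux : u x ≠ 0 := (ha.trans_le (hau x)).ne'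
    simp only [_root_.add_apply, _root_.smul_apply,
      ContinuousLinearMap.smulRight_apply, smul_eq_mul]
    field_simp
    ring

/-- `(∇u)²_{Ċ} ≥ 0` for `Ċ ≥ 0`: `Σ_{kl} C_{kl} v_k v_l ≥ 0`. [cite: BauerschmidtBodineauDagallier2023, Lemma 1 (proof)] -/
theorem sum_sum_mul_mul_self_nonneg {C : Matrix (Fin N) (Fin N) ℝ} (hC : C.PosSemidef) (v : Fin N → ℝ) :
    0 ≤ ∑ k, ∑ l, C k l * (v k * v l) := by
  have h := hC.dotProduct_mulVec_nonneg v
  have he : star v ⬝ᵥ (C *ᵥ v) = ∑ k, ∑ l, C k l * (v k * v l) := by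
    simp only [dotProduct, Matrix.mulVec, star_trivial, Finset.mul_sum]
    exact Finset.sum_congr rfl fun k _ => Finset.sum_congr rfl fun l _ => by ring
  rw [he] at h
  exact h

/-! ### The pointwise exchange inequality ([BBD] Lemma 1 + (e:assCt-mon)) -/

/-- **The exchange inequality for `H = (∇√u)²_{Ċ}`, `u = W/Z`, in the atoms** ([BBD] Lemma 1, p0016 L115 –
p0017, combined with the multiscale condition (e:assCt-mon) as on p0016 L150–153).  Data: `C_b²` atoms
`Z, W, Z₁ₖ = ∂_kZ, W₁ₖ = ∂_kW` (compatible: `DZ·e_k = Z₁ₖ`, `D²Z(e_i,e_j) = DZ₁ⱼ·e_i`, symmetric second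
jets), `Z ≥ m > 0`, `W ≥ aZ` (`u ≥ a > 0`), `Ċ = C` positive semidefinite symmetric, `C̈ = Cdd`; the derived
quantities `u, g_k = ∂_ku, A = (∇u)²_C, H = A/(4u)` and the time slopes `Ż = ½ΣC^{ab}∂_a∂_bZ`, `Ẇ`, `Ż₁ₖ`,
`Ẇ₁ₖ` (heat equations, [BBD] Prop 5), `u̇, ġ_k, Ȧ, Ḣ` (quotient/product rules) are passed with their
defining equations.  HYPOTHESIS `hms`: at every point, `λ (gᵀCg) ≤ (Cg)ᵀ Hess V_t (Cg) − ½ gᵀC̈g` with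
`Hess V_t = −∂²Z/Z + ∂Z⊗∂Z/Z²` (`V_t = −log Z`).  CONCLUSION: `C_b²` data for `H` and, at every point,
`2λ H ≤ (½Σ C^{ij}∂_i∂_jH − Σ C^{ij}∂_iV_t ∂_jH) − Ḣ` with `∂_iV_t = −Z₁ᵢ/Z` — the integrand of
`−d/dt E_{ν_t}[H_t] − 2λ̇_t E_{ν_t}[H_t] ≥ 0`. [cite: BauerschmidtBodineauDagallier2023, Lemma 1] -/
theorem sqrtGradient_exchange
    (pZ : (∀ x, HasFDerivAt Z (DZ x) x) ∧ (∀ x, HasFDerivAt DZ (D2Z x) x) ∧ (∀ x, |Z x| ≤ KZ0) ∧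
      (∀ x, ‖DZ x‖ ≤ KZ1) ∧ (∀ x, ‖D2Z x‖ ≤ KZ2) ∧ UniformContinuous D2Z)
    (pW : (∀ x, HasFDerivAt W (DW x) x) ∧ (∀ x, HasFDerivAt DW (D2W x) x) ∧ (∀ x, |W x| ≤ KW0) ∧
      (∀ x, ‖DW x‖ ≤ KW1) ∧ (∀ x, ‖D2W x‖ ≤ KW2) ∧ UniformContinuous D2W)
    {Z1 W1 : Fin N → EuclideanSpace ℝ (Fin N) → ℝ}
    {DZ1 DW1 : Fin N → EuclideanSpace ℝ (Fin N) → EuclideanSpace ℝ (Fin N) →L[ℝ] ℝ}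
    {D2Z1 D2W1 : Fin N → EuclideanSpace ℝ (Fin N) →
      EuclideanSpace ℝ (Fin N) →L[ℝ] EuclideanSpace ℝ (Fin N) →L[ℝ] ℝ}
    {LZ0 LZ1 LZ2 LW0 LW1 LW2 : ℝ}
    (pZ1 : ∀ k, (∀ x, HasFDerivAt (Z1 k) (DZ1 k x) x) ∧ (∀ x, HasFDerivAt (DZ1 k) (D2Z1 k x) x) ∧
      (∀ x, |Z1 k x| ≤ LZ0) ∧ (∀ x, ‖DZ1 k x‖ ≤ LZ1) ∧ (∀ x, ‖D2Z1 k x‖ ≤ LZ2) ∧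
      UniformContinuous (D2Z1 k))
    (pW1 : ∀ k, (∀ x, HasFDerivAt (W1 k) (DW1 k x) x) ∧ (∀ x, HasFDerivAt (DW1 k) (D2W1 k x) x) ∧
      (∀ x, |W1 k x| ≤ LW0) ∧ (∀ x, ‖DW1 k x‖ ≤ LW1) ∧ (∀ x, ‖D2W1 k x‖ ≤ LW2) ∧
      UniformContinuous (D2W1 k))
    (hZ1 : ∀ k x, DZ x (EuclideanSpace.single k 1) = Z1 k x)
    (hW1 : ∀ k x, DW x (EuclideanSpace.single k 1) = W1 k x)
    (hZ2 : ∀ i j x, D2Z x (EuclideanSpace.single i 1) (EuclideanSpace.single j 1) =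
      DZ1 j x (EuclideanSpace.single i 1))
    (hW2 : ∀ i j x, D2W x (EuclideanSpace.single i 1) (EuclideanSpace.single j 1) =
      DW1 j x (EuclideanSpace.single i 1))
    (hZ2s : ∀ i j x, DZ1 j x (EuclideanSpace.single i 1) = DZ1 i x (EuclideanSpace.single j 1))
    (hW2s : ∀ i j x, DW1 j x (EuclideanSpace.single i 1) = DW1 i x (EuclideanSpace.single j 1))
    (hm : 0 < m) (hmZ : ∀ x, m ≤ Z x) {a : ℝ} (ha : 0 < a) (haW : ∀ x, a * Z x ≤ W x)
    {C Cdd : Matrix (Fin N) (Fin N) ℝ} (hC : C.PosSemidef) (hCs : ∀ i j, C j i = C i j) {lam : ℝ}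
    (u : EuclideanSpace ℝ (Fin N) → ℝ) (hu : ∀ x, u x = W x * (Z x)⁻¹)
    (g : Fin N → EuclideanSpace ℝ (Fin N) → ℝ)
    (hg : ∀ k x, g k x = W1 k x * (Z x)⁻¹ - W x * (Z1 k x * ((Z x)⁻¹ * (Z x)⁻¹)))
    (A : EuclideanSpace ℝ (Fin N) → ℝ) (hA : ∀ x, A x = ∑ k, ∑ l, C k l * (g k x * g l x))
    (H : EuclideanSpace ℝ (Fin N) → ℝ) (hH : ∀ x, H x = (1 / 4) * (A x * (u x)⁻¹))
    (Zd Wd : EuclideanSpace ℝ (Fin N) → ℝ) (Z1d W1d : Fin N → EuclideanSpace ℝ (Fin N) → ℝ)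
    (hZd : ∀ x, Zd x = (1 / 2) * ∑ i, ∑ j, C i j * DZ1 j x (EuclideanSpace.single i 1))
    (hWd : ∀ x, Wd x = (1 / 2) * ∑ i, ∑ j, C i j * DW1 j x (EuclideanSpace.single i 1))
    (hZ1d : ∀ k x, Z1d k x = (1 / 2) * ∑ i, ∑ j, C i j *
      D2Z1 k x (EuclideanSpace.single i 1) (EuclideanSpace.single j 1))
    (hW1d : ∀ k x, W1d k x = (1 / 2) * ∑ i, ∑ j, C i j *
      D2W1 k x (EuclideanSpace.single i 1) (EuclideanSpace.single j 1))
    (ud : EuclideanSpace ℝ (Fin N) → ℝ) (hud : ∀ x, ud x = Wd x / Z x - W x * Zd x / Z x ^ 2)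
    (gd : Fin N → EuclideanSpace ℝ (Fin N) → ℝ)
    (hgd : ∀ k x, gd k x = W1d k x / Z x - W1 k x * Zd x / Z x ^ 2 - Wd x * Z1 k x / Z x ^ 2
      - W x * Z1d k x / Z x ^ 2 + 2 * W x * Z1 k x * Zd x / Z x ^ 3)
    (Ad : EuclideanSpace ℝ (Fin N) → ℝ)
    (hAd : ∀ x, Ad x = 2 * (∑ k, ∑ l, C k l * (gd k x * g l x)) + ∑ k, ∑ l, Cdd k l * (g k x * g l x))
    (Hd : EuclideanSpace ℝ (Fin N) → ℝ)
    (hHd : ∀ x, Hd x = Ad x / (4 * u x) - A x * ud x / (4 * u x ^ 2))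
    (hms : ∀ x, lam * ((fun k => g k x) ⬝ᵥ (C *ᵥ fun k => g k x)) ≤
      (C *ᵥ fun k => g k x) ⬝ᵥ
          ((Matrix.of fun i k => -(DZ1 i x (EuclideanSpace.single k 1)) / Z x +
              Z1 i x * Z1 k x / Z x ^ 2) *ᵥ (C *ᵥ fun k => g k x)) -
        (1 / 2) * ((fun k => g k x) ⬝ᵥ (Cdd *ᵥ fun k => g k x))) :
    ∃ (DH : EuclideanSpace ℝ (Fin N) → EuclideanSpace ℝ (Fin N) →L[ℝ] ℝ)
      (D2H : EuclideanSpace ℝ (Fin N) → EuclideanSpace ℝ (Fin N) →L[ℝ] EuclideanSpace ℝ (Fin N) →L[ℝ] ℝ)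
      (K0 K1 K2 : ℝ),
      ((∀ x, HasFDerivAt H (DH x) x) ∧ (∀ x, HasFDerivAt DH (D2H x) x) ∧ (∀ x, |H x| ≤ K0) ∧
        (∀ x, ‖DH x‖ ≤ K1) ∧ (∀ x, ‖D2H x‖ ≤ K2) ∧ UniformContinuous D2H) ∧
      ∀ x, 2 * lam * H x ≤
        ((1 / 2) * (∑ i, ∑ j, C i j * D2H x (EuclideanSpace.single i 1) (EuclideanSpace.single j 1)) -
          ∑ i, ∑ j, C i j * ((-Z1 i x / Z x) * DH x (EuclideanSpace.single j 1))) - Hd x := by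
  obtain ⟨Du, D2u, KU1, KU2, pu, hDu, hD2u⟩ := quotient_jets pZ pW hm hmZ u hu
  have hgk := fun k => gradQuotient_jets pZ pW (pZ1 k) (pW1 k) hm hmZ (g k) (hg k)
  choose Dg D2g G0 G1 G2 pg hDg hD2g using hgk
  have pg' : ∀ k, (∀ x, HasFDerivAt (g k) (Dg k x) x) ∧ (∀ x, HasFDerivAt (Dg k) (D2g k x) x) ∧
      (∀ x, |g k x| ≤ ∑ j, |G0 j|) ∧ (∀ x, ‖Dg k x‖ ≤ ∑ j, |G1 j|) ∧ (∀ x, ‖D2g k x‖ ≤ ∑ j, |G2 j|) ∧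
      UniformContinuous (D2g k) :=
    fun k => pack_mono (pg k) (le_sum_abs G0 k) (le_sum_abs G1 k) (le_sum_abs G2 k)
  obtain ⟨DA, D2A, KA0, KA1, KA2, pA, hDA, hD2A⟩ := quadForm_jets pg' C A hA
  have hau : ∀ x, a ≤ u x := fun x => by
    rw [hu, ← div_eq_mul_inv, le_div_iff₀ (hm.trans_le (hmZ x))]
    exact haW x
  obtain ⟨DH, D2H, K0, K1, K2, pH, hDH, hD2H⟩ := sqrtEnergy_jets pu pA ha hau H hH
  refine ⟨DH, D2H, K0, K1, K2, pH, fun x => ?_⟩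
  -- the jets at the point `x`
  have hZ : Z x ≠ 0 := (hm.trans_le (hmZ x)).ne'
  have hux : 0 < u x := ha.trans_le (hau x)
  have hgDu : ∀ k, Du x (EuclideanSpace.single k 1) = g k x := fun k => by
    rw [hDu, hZ1, hW1, hg]
    ring
  have hCT : Cᵀ = C := Matrix.ext fun i j => hCs i j
  -- `M_{jk} = ∂_k g_j`, `R_{ik} = ∂_i∂_k V_t`
  set M : Matrix (Fin N) (Fin N) ℝ := Matrix.of fun j k => Dg j x (EuclideanSpace.single k 1) with hMdef
  have hMjk : ∀ j k, M j k = DW1 j x (EuclideanSpace.single k 1) / Z x - W1 j x * Z1 k x / Z x ^ 2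
      - W1 k x * Z1 j x / Z x ^ 2 - W x * DZ1 j x (EuclideanSpace.single k 1) / Z x ^ 2
      + 2 * W x * Z1 j x * Z1 k x / Z x ^ 3 := by
    intro j k
    simp only [hMdef, Matrix.of_apply]
    rw [hDg, hZ1, hW1]
  have hMT : Mᵀ = M := by
    refine Matrix.ext fun j k => ?_
    rw [Matrix.transpose_apply, hMjk, hMjk, hW2s k j x, hZ2s k j x]
    ring
  set R : Matrix (Fin N) (Fin N) ℝ := Matrix.of fun i k =>
    -(DZ1 i x (EuclideanSpace.single k 1)) / Z x + Z1 i x * Z1 k x / Z x ^ 2 with hRdef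
  -- (1) `u̇ = L u` in jet form
  have h1 : ud x = (1 / 2) * (∑ i, ∑ j, C i j * M j i) -
      ∑ i, ∑ j, C i j * ((-Z1 i x / Z x) * g j x) := by
    have h := jet_generator (n := Fin N) hCs hZ (W := W x) (Z1 := fun i => Z1 i x)
      (W1 := fun i => W1 i x) (g := fun k => g k x) (p := fun i => -Z1 i x / Z x)
      (Z2 := fun i j => DZ1 j x (EuclideanSpace.single i 1))
      (W2 := fun i j => DW1 j x (EuclideanSpace.single i 1)) (N := fun i j => M j i)
      (Zd := Zd x) (Wd := Wd x) (ud := ud x)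
      (fun i j => hZ2s j i x) (fun i j => hW2s j i x)
      (fun k => by rw [hg]; ring) (fun i => rfl)
      (fun i j => hMjk j i) (hZd x) (hWd x) (hud x)
    exact h
  -- (2) `ġ_k = ∂_k L u` in jet form
  have h2 : ∀ k, gd k x = (1 / 2) * (∑ i, ∑ j, C i j *
      D2g k x (EuclideanSpace.single i 1) (EuclideanSpace.single j 1)) -
      ∑ i, ∑ j, C i j * (R i k * g j x + (-Z1 i x / Z x) * M j k) := by
    intro k
    have h := jet_gradient_generator (n := Fin N) hCs hZ (W := W x) (Z1 := fun i => Z1 i x)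
      (W1 := fun i => W1 i x) (g := fun k => g k x) (p := fun i => -Z1 i x / Z x)
      (Z1d := fun k => Z1d k x) (W1d := fun k => W1d k x) (gd := fun k => gd k x)
      (Z2 := fun i j => DZ1 j x (EuclideanSpace.single i 1))
      (W2 := fun i j => DW1 j x (EuclideanSpace.single i 1)) (M := fun j k => M j k)
      (R := fun i k => R i k)
      (Z3 := fun i j k => D2Z1 k x (EuclideanSpace.single i 1) (EuclideanSpace.single j 1))
      (W3 := fun i j k => D2W1 k x (EuclideanSpace.single i 1) (EuclideanSpace.single j 1))
      (T := fun k i j => D2g k x (EuclideanSpace.single i 1) (EuclideanSpace.single j 1))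
      (Zd := Zd x) (Wd := Wd x)
      (fun i j => hZ2s j i x) (fun i j => hW2s j i x)
      (fun k => by rw [hg]; ring) (fun i => rfl)
      (fun j k => hMjk j k) (fun i k => rfl)
      (fun k i j => by
        rw [hD2g, hZ1, hZ1, hW1, hW1, hZ2, hW2]
        ring)
      (hZd x) (hWd x) (fun k => hZ1d k x) (fun k => hW1d k x) (fun k => hgd k x) k
    exact h
  -- (3) the Bochner inequality
  have key := bochner_sqrt_ineq (n := Fin N) hC hCT hMT hux h1 h2 (hms x)
    (Cdd := Cdd) (A := A x) (H := H x) (Hd := Hd x) (Ad := Ad x)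
    (dA := fun j => DA x (EuclideanSpace.single j 1))
    (dH := fun j => DH x (EuclideanSpace.single j 1))
    (d2A := fun i j => D2A x (EuclideanSpace.single i 1) (EuclideanSpace.single j 1))
    (d2H := fun i j => D2H x (EuclideanSpace.single i 1) (EuclideanSpace.single j 1))
    (U2 := fun i j => D2u x (EuclideanSpace.single i 1) (EuclideanSpace.single j 1))
    (hA x) (fun j => hDA x _) (fun i j => hD2A x _ _)
    (fun i j => by
      rw [hD2u, hZ1, hZ1, hW1, hW1, hZ2, hW2, hMjk]
      ring)
    (by rw [hH]; ring)
    (fun j => by rw [hDH, hgDu])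
    (fun i j => by rw [hD2H, hgDu, hgDu])
    rfl (hAd x) (hHd x)
  exact key

end Jets

end Polchinski

end Literature.Analysis.FunctionSpaces

end
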